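import Summits.RiemannHypothesis.RiemannHypothesis.Theorems.TiltedLandingLaw421R3Bot
import Summits.RiemannHypothesis.RiemannHypothesis.Theorems.TiltedLandingLaw421R2CoreP
import Summits.RiemannHypothesis.RiemannHypothesis.Theorems.TiltedLandingLaw421R2InitR

/-! # TiltedLandingLaw421 — W-08 round 3: KERNEL-DESK ADD-ON over the TREE modules (C4 g26 RE-IMAGE of `initBotR3-revb-W08-C4-rh-idea-6-g26.lean` 4cd6c3fe786a7a25)
Same bytes as the checked add-on (§K.19 «no silent extinction» texts of `RestSuccBot`, §K.20 `restInitBot : RestInitBot` + `restRateBot_zero`, §K.21 STEP form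
`restRateBot_iff_step`), with C1's 832-line base REPLACED by `import …TiltedLandingLaw421R3Bot` (tenure E09 module 2, 36dc1e70, cut verbatim from that base) and the
§K.17 INIT♯ body REPLACED by `import …TiltedLandingLaw421R2InitR` (= `initR-revb-W08-C4-rh-idea-6-g26.lean` b68a41194eb777fa landed under that name).
STATUS AT WRITING (04:35Z): UNCHECKED — neither module is in the tree yet ((CA330) PART 1 pending lead g10; InitR pending βR hand/lead). Check = `lean check` rc 0,
0 sorry, axioms STD on `RhW08.SealSwap.restRateBot_iff_step`; if the InitR tree name differs, fix the third import line only.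
Files-only cell: NOT proposed by C4 (landing = hand/lead, `--supports stmt-RiemannHypothesis-24774 --as helper`). Typed ≠ proved for the stubs; RH is NOT proved; 24774 OPEN. -/

open Complex

/-! ## §K.19 — `RestSuccBot` (stub 1 of round 3 = C1 §R3B `RestSuccBot`, WORDS-53a/53b, director (CA329)(b)) REDUCED to «NO SILENT EXTINCTION» of the tracked lineage, two equivalent texts -/

namespace RhW08.SealSwap

open RhIdea6.G17.W07C7 RhIdea6.G17.W07C7.Rev6 RhIdea6.G18.W07C8.Law421BirthS RhIdea6.G19.W07C11.Seam
open RhIdea6.G20.W07C12.Frac RhIdea6.G20.W07C12.StColP RhW07.C12.FieldSplit RhIdea6.G21.W07C13.TentMax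
open RhW07.C14.TwoSided RhW07.C14.Classes RhW07.C14.Lineage RhW07.C14.Booking
open RhW07.C13.Heredity RhIdea6.G22.W07C15pre.Injection RhW07.E3.Cell
open RhW07.E3.Lit
open RhW08.Round1 RhW08.StSwap RhW08.Round2

section NoExtinction

/-- ★★ §K.19 «NO SILENT EXTINCTION» (tracked text): a tracked level holding a NON-READY state has an inhabited next TRACKED level. -/
def NoExtinctTrkD : Prop :=
  ∀ (η : ℝ) (f : ℂ → ℂ) (x₀ s hmax R Hs : ℝ) (B : ℕ), EngineHyps5 2 η f x₀ s hmax R Hs B →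
    ∀ (j : ℕ) (v : ℂ), StTrkD η f x₀ s hmax R Hs B j v → ¬ ReadyR2 η f x₀ s hmax R Hs B j v → ∃ u' : ℂ, StTrkD η f x₀ s hmax R Hs B (j + 1) u'

/-- ★★ §K.19 «SUCCESSION OR TILT» (column text — the ANALYTIC target): if `f^{(j)}` has a tracked upper zero at a level `j` that is not yet `Ready′`
(`CumReady (WindowReady ∨ TiltReady)`), then `f^{(j+1)}` has an upper zero in the widened column window (`StCol' … (j+1)`). -/
def SuccOrTiltCol : Prop :=
  ∀ (η : ℝ) (f : ℂ → ℂ) (x₀ s hmax R Hs : ℝ) (B : ℕ), EngineHyps5 2 η f x₀ s hmax R Hs B →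
    ∀ (j : ℕ) (v : ℂ), StTrkD η f x₀ s hmax R Hs B j v → ¬ ReadyR2 η f x₀ s hmax R Hs B j v → ∃ w : ℂ, StCol' η f x₀ s hmax R Hs B (j + 1) w

/-- ★★ §K.19 (K) the two texts agree: a populated finite next `StCol'` level always admits a down-first step (#999 `exists_trkStepD`), and a tracked state is a column state. -/
theorem noExtinctTrkD_iff_succOrTiltCol : NoExtinctTrkD ↔ SuccOrTiltCol := by
  constructor
  · intro h η f x₀ s hmax R Hs B hE j v hv hnr
    obtain ⟨u', hu'⟩ := h η f x₀ s hmax R Hs B hE j v hv hnr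
    exact ⟨u', stCol'_of_stTrkD hu'⟩
  · intro h η f x₀ s hmax R Hs B hE j v hv hnr
    obtain ⟨w, hw⟩ := h η f x₀ s hmax R Hs B hE j v hv hnr
    obtain ⟨u', hstep⟩ := exists_trkStepD v (stColP_level_finite hE (j + 1)) ⟨w, hw⟩
    exact ⟨u', stTrkD_succ hv hstep⟩

/-- ★★★ §K.19 (K) **stub 1 ⟺ no silent extinction**: `RestSuccBot ↔ NoExtinctTrkD` (→: the lowest state of the level is non-ready too (`Ready′` is state-free);
either it already has an s/4-lower tracked successor, or the level is charged under the empty seal; ←: a charged level holds a non-ready tracked state). -/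
theorem restSuccBot_iff_noExtinct : RestSuccBot ↔ NoExtinctTrkD := by
  constructor
  · intro h η f x₀ s hmax R Hs B hE j v hv hnr
    obtain ⟨v₀, hlow⟩ := hasLowestSig_of_levelFinite levelFinite_stTrkD η f x₀ s hmax R Hs B hE j v hv
    have hnr₀ : ¬ ReadyR2 η f x₀ s hmax R Hs B j v₀ := fun hr => hnr (stateFree_readyR2 η f x₀ s hmax R Hs B j v₀ v hr)
    by_cases hsucc : SuccOf (1 / 4) StTrkD η f x₀ s hmax R Hs B j v₀
    · obtain ⟨u', hu', -⟩ := hsucc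
      exact ⟨u', hu'⟩
    · have hC : Charged (PTrkS PBot) StTrkD ReadyR2 η f x₀ s hmax R Hs B j := by
        refine ⟨v₀, hlow, hnr₀, ?_⟩
        rintro (hb | hs')
        · exact hb
        · exact hsucc hs'
      exact h η f x₀ s hmax R Hs B hE j hC
  · intro h η f x₀ s hmax R Hs B hE j hC
    obtain ⟨v, hlow, hnr, -⟩ := hC
    exact h η f x₀ s hmax R Hs B hE j v hlow.1 hnr

/-- ★★ §K.19 (K) hence stub 1 ⟺ «succession or tilt» on the column states. -/
theorem restSuccBot_iff_succOrTiltCol : RestSuccBot ↔ SuccOrTiltCol :=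
  restSuccBot_iff_noExtinct.trans noExtinctTrkD_iff_succOrTiltCol

/-- ★ §K.19 (K) and stub 1 is exactly the (S♮) conjunct of the rate form at the empty seal: `RateRestTrkS PBot → RestSuccBot`. -/
theorem restSuccBot_of_rate (h : RateRestTrkS PBot) : RestSuccBot :=
  fun η f x₀ s hmax R Hs B hE j hC => (h η f x₀ s hmax R Hs B hE).1 j hC

end NoExtinction

end RhW08.SealSwap

/-! ## §K.20 — INIT♯ DISCHARGED on C1's round-3 base: `RhW08.SealSwap.restInitBot : RestInitBot`, and the `k = 0` instance of STUB 2 `RestRateBot` PROVED (C4 g26) -/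

namespace RhW08.SealSwap

open RhIdea6.G17.W07C7 RhIdea6.G17.W07C7.Rev6 RhIdea6.G18.W07C8.Law421BirthS RhIdea6.G19.W07C11.Seam
open RhIdea6.G20.W07C12.Frac RhIdea6.G20.W07C12.StColP RhW07.C12.FieldSplit RhIdea6.G21.W07C13.TentMax
open RhW07.C14.TwoSided RhW07.C14.Classes RhW07.C14.Lineage RhW07.C14.Booking
open RhW07.C13.Heredity RhIdea6.G22.W07C15pre.Injection RhW07.E3.Cell
open RhW07.E3.Lit
open RhW08.Round1 RhW08.StSwap RhW08.Round2

section InitDischarge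

/-- ★★★ §K.20 **`RestInitBot` HOLDS on all legal data** — C4 §K.17 `RhW08.Round2.tentMeterTrkD_zero_le_purse` through C1 §R3B `restInitBot_iff_purse`:
the k-0 INIT♯ of the round-3 line (director (CA328)(3): «believed provable now») is a THEOREM, not a stub. -/
theorem restInitBot : RestInitBot :=
  restInitBot_iff_purse.mpr fun _ _ _ _ _ _ _ _ hE => RhW08.Round2.tentMeterTrkD_zero_le_purse hE

/-- (K) the injection count below level `0` vanishes. -/
theorem injected_zero (P St Ready : StatePred) (𝓔 : LevelClass) (η : ℝ) (f : ℂ → ℂ) (x₀ s hmax R Hs : ℝ) (B : ℕ) :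
    injected P St Ready 𝓔 η f x₀ s hmax R Hs B 0 = 0 := by
  simp [injected]

open Classical in
/-- ★★★ §K.20 **the `k = 0` instance of STUB 2 `RestRateBot` is PROVED**: at the root the rate inequality reads `max T₀ᴿ 0 + 4·rootHeight/s ≤ (Hs/s)² + B + 1 + 4·hmax/s`,
which is INIT♯ (`tentMeterTrkD_zero_le_purse`) plus `rootHeight ≤ hmax` (`rootHeight_stTrkD_le_hmax`). So `stub_restRateBot` carries content only at `k ≥ 1`. -/
theorem restRateBot_zero {η : ℝ} {f : ℂ → ℂ} {x₀ s hmax R Hs : ℝ} {B : ℕ} (hE : EngineHyps5 2 η f x₀ s hmax R Hs B) :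
    chargeCount (PTrkS PBot) StTrkD ReadyR2 η f x₀ s hmax R Hs B 0
        + max (tentMeterTrkD (3 / 2) η f x₀ s hmax R Hs B 0 - injected (PTrkS PBot) StTrkD ReadyR2 EmptyTrkD η f x₀ s hmax R Hs B 0) 0
        + 4 * lowH StTrkD η f x₀ s hmax R Hs B 0 / s
        + (∑ j ∈ Finset.range 0, (if Charged (PTrkS PBot) StTrkD ReadyR2 η f x₀ s hmax R Hs B j then 0 else
            4 * (lowH StTrkD η f x₀ s hmax R Hs B j - lowH StTrkD η f x₀ s hmax R Hs B (j + 1)) / s))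
      ≤ (Hs / s) ^ 2 + (B : ℝ) + 1 + 4 * hmax / s := by
  have h0 := RhW08.Round2.tentMeterTrkD_zero_le_purse hE
  have hroot := RhW08.Round2.rootHeight_stTrkD_le_hmax hE
  have hs : 0 < s := hE.2.2.2.1
  rw [chargeCount_zero, injected_zero, Finset.sum_range_zero, lowH_zero, sub_zero, zero_add, add_zero]
  have hsplit : 4 * (hmax - rootHeight StTrkD η f x₀ s hmax R Hs B) / s
      = 4 * hmax / s - 4 * rootHeight StTrkD η f x₀ s hmax R Hs B / s := by ring
  have hdiff : 0 ≤ 4 * (hmax - rootHeight StTrkD η f x₀ s hmax R Hs B) / s :=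
    div_nonneg (by linarith) hs.le
  have hA : 0 ≤ (Hs / s) ^ 2 + (B : ℝ) + 1 := by positivity
  have hmax' : max (tentMeterTrkD (3 / 2) η f x₀ s hmax R Hs B 0) 0
      ≤ (Hs / s) ^ 2 + (B : ℝ) + 1 + 4 * (hmax - rootHeight StTrkD η f x₀ s hmax R Hs B) / s :=
    max_le h0 (by linarith)
  linarith

/-- (K) §K.20 consistency: C1's `restInitBot_of_rate` direction and the theorem agree — `RestInitBot` needs no stub at all. -/
example : RestInitBot := restInitBot

end InitDischarge

end RhW08.SealSwap
/-! ## §K.21 — STUB 2 `RestRateBot` has content ONLY RIGHT AFTER CHARGED LEVELS: the STEP form `RestStepBot` (`RestRateBot ↔ RestStepBot`), and the accounting is frozen once the lineage is Ready′ -/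

namespace RhW08.SealSwap

open RhIdea6.G17.W07C7 RhIdea6.G17.W07C7.Rev6 RhIdea6.G18.W07C8.Law421BirthS RhIdea6.G19.W07C11.Seam
open RhIdea6.G20.W07C12.Frac RhIdea6.G20.W07C12.StColP RhW07.C12.FieldSplit RhIdea6.G21.W07C13.TentMax
open RhW07.C14.TwoSided RhW07.C14.Classes RhW07.C14.Lineage RhW07.C14.Booking
open RhW07.C13.Heredity RhIdea6.G22.W07C15pre.Injection RhW07.E3.Cell
open RhW07.E3.Lit
open RhW08.Round1 RhW08.StSwap RhW08.Round2

section StepForm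

open Classical in
/-- §K.21 the left-hand side of STUB 2's inequality at prefix `k` (the «rate account» `L k`). -/
noncomputable def rateLHSBot (η : ℝ) (f : ℂ → ℂ) (x₀ s hmax R Hs : ℝ) (B k : ℕ) : ℝ :=
  chargeCount (PTrkS PBot) StTrkD ReadyR2 η f x₀ s hmax R Hs B k
    + max (tentMeterTrkD (3 / 2) η f x₀ s hmax R Hs B 0 - injected (PTrkS PBot) StTrkD ReadyR2 EmptyTrkD η f x₀ s hmax R Hs B k) 0
    + 4 * lowH StTrkD η f x₀ s hmax R Hs B k / s
    + (∑ j ∈ Finset.range k, (if Charged (PTrkS PBot) StTrkD ReadyR2 η f x₀ s hmax R Hs B j then 0 else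
        4 * (lowH StTrkD η f x₀ s hmax R Hs B j - lowH StTrkD η f x₀ s hmax R Hs B (j + 1)) / s))

/-- (K) §K.21 STUB 2 read through the account: `RestRateBot ↔ ∀ legal k, L k ≤ purse` (definitional). -/
theorem restRateBot_iff_lhs : RestRateBot ↔
    ∀ (η : ℝ) (f : ℂ → ℂ) (x₀ s hmax R Hs : ℝ) (B : ℕ), EngineHyps5 2 η f x₀ s hmax R Hs B →
      ∀ k : ℕ, rateLHSBot η f x₀ s hmax R Hs B k ≤ (Hs / s) ^ 2 + (B : ℝ) + 1 + 4 * hmax / s :=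
  Iff.rfl

open Classical in
/-- (K) §K.21 an uncharged level injects nothing. -/
theorem injected_succ_of_not_charged {P St Ready : StatePred} {𝓔 : LevelClass} {η : ℝ} {f : ℂ → ℂ} {x₀ s hmax R Hs : ℝ} {B k : ℕ}
    (h : ¬ Charged P St Ready η f x₀ s hmax R Hs B k) :
    injected P St Ready 𝓔 η f x₀ s hmax R Hs B (k + 1) = injected P St Ready 𝓔 η f x₀ s hmax R Hs B k := by
  unfold injected
  rw [Finset.sum_range_succ]
  simp only [h, false_and, if_false, add_zero]

open Classical in
/-- ★★ §K.21 (K) **the account is FROZEN across an uncharged level**: `¬Charged k → L (k+1) = L k` (the free drop term cancels the `lowH` change exactly; no charge, no injection). -/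
theorem rateLHSBot_succ_of_not_charged {η : ℝ} {f : ℂ → ℂ} {x₀ s hmax R Hs : ℝ} {B k : ℕ}
    (h : ¬ Charged (PTrkS PBot) StTrkD ReadyR2 η f x₀ s hmax R Hs B k) :
    rateLHSBot η f x₀ s hmax R Hs B (k + 1) = rateLHSBot η f x₀ s hmax R Hs B k := by
  simp only [rateLHSBot, chargeCount_succ, Finset.sum_range_succ, injected_succ_of_not_charged h, h, if_false]
  ring

open Classical in
/-- ★ §K.21 (K) across a CHARGED level the account moves by `1 − 4·(lowH k − lowH (k+1))/s` plus the change of the unspent credit `(T₀ᴿ − injected ·)⁺` (which is `0` or drops by at most `1`). -/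
theorem rateLHSBot_succ_of_charged {η : ℝ} {f : ℂ → ℂ} {x₀ s hmax R Hs : ℝ} {B k : ℕ}
    (h : Charged (PTrkS PBot) StTrkD ReadyR2 η f x₀ s hmax R Hs B k) :
    rateLHSBot η f x₀ s hmax R Hs B (k + 1) = rateLHSBot η f x₀ s hmax R Hs B k + 1
      - 4 * (lowH StTrkD η f x₀ s hmax R Hs B k - lowH StTrkD η f x₀ s hmax R Hs B (k + 1)) / s
      + (max (tentMeterTrkD (3 / 2) η f x₀ s hmax R Hs B 0 - injected (PTrkS PBot) StTrkD ReadyR2 EmptyTrkD η f x₀ s hmax R Hs B (k + 1)) 0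
         - max (tentMeterTrkD (3 / 2) η f x₀ s hmax R Hs B 0 - injected (PTrkS PBot) StTrkD ReadyR2 EmptyTrkD η f x₀ s hmax R Hs B k) 0) := by
  simp only [rateLHSBot, chargeCount_succ, Finset.sum_range_succ, h, if_true]
  ring

/-- ★★ §K.21 the STEP form of STUB 2: the purse inequality is demanded only at prefixes `k + 1` with level `k` CHARGED. -/
def RestStepBot : Prop :=
  ∀ (η : ℝ) (f : ℂ → ℂ) (x₀ s hmax R Hs : ℝ) (B : ℕ), EngineHyps5 2 η f x₀ s hmax R Hs B →
    ∀ k : ℕ, Charged (PTrkS PBot) StTrkD ReadyR2 η f x₀ s hmax R Hs B k →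
      rateLHSBot η f x₀ s hmax R Hs B (k + 1) ≤ (Hs / s) ^ 2 + (B : ℝ) + 1 + 4 * hmax / s

/-- ★★★ §K.21 (K) **`RestRateBot ↔ RestStepBot`**: with the `k = 0` instance PROVED (`restRateBot_zero`, §K.20) and the account frozen across uncharged levels, STUB 2 is exactly
«after every CHARGED level the account still fits the purse» (induction on `k`). -/
theorem restRateBot_iff_step : RestRateBot ↔ RestStepBot := by
  constructor
  · intro h η f x₀ s hmax R Hs B hE k _
    exact h η f x₀ s hmax R Hs B hE (k + 1)
  · intro h η f x₀ s hmax R Hs B hE k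
    show rateLHSBot η f x₀ s hmax R Hs B k ≤ _
    induction k with
    | zero => exact restRateBot_zero hE
    | succ k ih =>
      by_cases hC : Charged (PTrkS PBot) StTrkD ReadyR2 η f x₀ s hmax R Hs B k
      · exact h η f x₀ s hmax R Hs B hE k hC
      · rw [rateLHSBot_succ_of_not_charged hC]; exact ih

/-- ★ §K.21 (K) hence the round-3 crux reduction reads: «succession or tilt» + «the account fits the purse after every charged level» ⇒ `TiltedLandingLaw421`. -/
theorem law421T_of_succOrTilt_step (hC : SuccOrTiltCol) (hS : RestStepBot) :
    Summit.RiemannHypothesis.RiemannHypothesis.Theses.EarlyAppointments.TiltedLandingLaw421 :=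
  law421T_of_succ_rate (restSuccBot_iff_succOrTiltCol.mpr hC) (restRateBot_iff_step.mpr hS)

/-- (K) §K.21 Ready′ is CUMULATIVE in the level (and state-free): once some state is Ready′ at level `j₀`, every state is Ready′ at every later level. -/
theorem readyR2_mono {η : ℝ} {f : ℂ → ℂ} {x₀ s hmax R Hs : ℝ} {B j₀ j : ℕ} {v₀ v : ℂ}
    (h : ReadyR2 η f x₀ s hmax R Hs B j₀ v₀) (hj : j₀ ≤ j) : ReadyR2 η f x₀ s hmax R Hs B j v := by
  have h' : ReadyR2 η f x₀ s hmax R Hs B j₀ v := stateFree_readyR2 η f x₀ s hmax R Hs B j₀ v₀ v h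
  obtain ⟨j', hj', hR⟩ := h'
  exact ⟨j', hj'.trans hj, hR⟩

/-- ★ §K.21 (K) **no charge after Ready′**: a level at or after a Ready′ level is never charged — so the account is frozen from the first Ready′ level on
(`rateLHSBot_succ_of_not_charged`), and STUB 2 concerns only the pre-horizon prefix. -/
theorem not_charged_of_readyR2 {η : ℝ} {f : ℂ → ℂ} {x₀ s hmax R Hs : ℝ} {B j₀ j : ℕ} {v₀ : ℂ}
    (h : ReadyR2 η f x₀ s hmax R Hs B j₀ v₀) (hj : j₀ ≤ j) : ¬ Charged (PTrkS PBot) StTrkD ReadyR2 η f x₀ s hmax R Hs B j := by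
  rintro ⟨v, -, hnr, -⟩
  exact hnr (readyR2_mono h hj)

/-- ★ §K.21 (K) the account is CONSTANT from the first Ready′ level on. -/
theorem rateLHSBot_eq_of_readyR2 {η : ℝ} {f : ℂ → ℂ} {x₀ s hmax R Hs : ℝ} {B j₀ : ℕ} {v₀ : ℂ}
    (h : ReadyR2 η f x₀ s hmax R Hs B j₀ v₀) : ∀ k : ℕ, j₀ ≤ k → rateLHSBot η f x₀ s hmax R Hs B k = rateLHSBot η f x₀ s hmax R Hs B j₀ := by
  intro k hk
  induction k with
  | zero =>
    have : j₀ = 0 := Nat.le_zero.mp hk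
    subst this; rfl
  | succ k ih =>
    rcases Nat.lt_or_ge k j₀ with hlt | hge
    · have : j₀ = k + 1 := by omega
      subst this; rfl
    · rw [rateLHSBot_succ_of_not_charged (not_charged_of_readyR2 h hge)]
      exact ih hge

end StepForm

end RhW08.SealSwap
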